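import Summits.HubbardSuperconductivity.HubbardSuperconductivity.Theses.LiebTwin
import Literature.MathematicalPhysics.QuantumLattice.PairFieldYangCeiling
import Literature.MathematicalPhysics.QuantumLattice.HubbardRingPerronFrobeniusProofs
import Literature.Barriers.HubbardSuperconductivity.PureModelStripeCompetitionProofs

/-!
# Route `LiebTwin`, crux `TwinOnsiteCondensation` (stmt-HubbardSuperconductivity-15258), line `birth`:
# the cut through the attractive sibling loses nothing (helper, `--supports`)

Line `birth` composes K2 = `TwinOnsiteCondensation` from stub T (`stub_twinDominatesAttractive`: the twin
of every repulsive sector ground state dominates `θ·F_s` of an attractive sector ground state at some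
`U' < 0`) and stub A (`stub_attractiveOnsiteLRO`). This file machine-checks the converse bookkeeping the
line card asserts ("strictly weaker than K2: K2 and the a-priori cap give it"):

* `sum_sq_sWave`, `sWave_neg` — the on-site form factor has `Σ_e g(e)² = 1` and is even;
* `re_expect_pairField_sWave_le` — **Yang's cap in the crux's normalisation**: every vector `ψ` of the
  `(n, n)` sector of the torus of side `L ≥ 3`, `n ≤ L²`, has
  `Re⟨ψ, Δ_sᴴ Δ_s ψ⟩ ≤ 2n(L² - n + 1)‖ψ‖² ≤ 2L⁴‖ψ‖²` (`Δ_s = pairField sWave L`);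
* `twinDominatesAttractive_of_twinOnsiteCondensation` — **K2 ⟹ T** with `U' = -1`, `θ = c/2`: a
  normalised attractive sector ground state exists (`exists_unit_isGroundStateInSector_hubbardTorus`) and
  obeys the cap, so `θ·F_s(ψ) ≤ (c/2)·2L⁴ = cL⁴ ≤ F_s(φ̃)`.

Hence, given stub A, stub T is EQUIVALENT to K2: the decomposition of line `birth` is exact, and all of
K2's content sits in T. Sources: C. N. Yang, Rev. Mod. Phys. **34** (1962) 694, §4 (the bound
`λ_max(ρ₂) ≤ N(M - N + 2)/M`); E. H. Lieb, PRL **62** (1989) 1201 (sector ground states). No definition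
and no named fact is introduced.
-/

-- the mandated namespace `Summit.<Summit>.<Problem>.Theorems` repeats `HubbardSuperconductivity`
-- (single-problem summit, D-0017), which the `dupNamespace` linter flags on every declaration
set_option linter.dupNamespace false

noncomputable section

namespace Summit.HubbardSuperconductivity.HubbardSuperconductivity.Theorems.LiebTwinTwin

open Matrix Finset Literature.MathematicalPhysics.QuantumLattice Literature.Probability.LatticeModels
open Summit.HubbardSuperconductivity.HubbardSuperconductivity.Theses.LiebTwin Literature.Barriers.HubbardSuperconductivity
open scoped ComplexOrder MatrixOrder Matrix.Norms.L2Operator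

/-! ### The on-site form factor -/

/-- `Σ_{e ∈ {0} ∪ unitSteps} sWave(e)² = 1` (only the step `e = 0` carries weight).
Scalapino, Phys. Rep. 250 (1995) 329, §2. [folklore] -/
theorem sum_sq_sWave : ∑ e ∈ insert (0 : Site 2) unitSteps, sWave e ^ 2 = 1 := by
  rw [Finset.sum_insert (by decide : (0 : Site 2) ∉ unitSteps)]
  have h0 : sWave 0 = 1 := if_pos rfl
  have h1 : ∀ e ∈ unitSteps, sWave e ^ 2 = 0 := by
    intro e he
    have hne : e ≠ 0 := fun h => (by decide : (0 : Site 2) ∉ unitSteps) (h ▸ he)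
    simp [sWave, hne]
  rw [h0, Finset.sum_congr rfl h1, Finset.sum_const_zero]
  norm_num

/-- The on-site form factor is even, `sWave (-e) = sWave e`. Scalapino, Phys. Rep. 250 (1995) 329, §2.
[folklore] -/
theorem sWave_neg (e : Site 2) : sWave (-e) = sWave e := by
  simp [sWave, neg_eq_zero]

/-! ### Yang's cap in the crux's normalisation -/

/-- **Yang's cap for the on-site pair field of a sector vector.** For `L ≥ 3`, `n ≤ L²` and every vector
`ψ` of the `(n, n)` sector of the torus of side `L`:
`Re⟨ψ, Δ_sᴴ Δ_s ψ⟩ ≤ 2n(L² - n + 1)·‖ψ‖²` (`N = 2n` particles on `M = 2L²` orbitals, `‖φ_s‖² = L²`).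
Yang, Rev. Mod. Phys. 34 (1962) 694, §4; Scalapino, Phys. Rep. 250 (1995) 329, §2. [folklore] -/
theorem re_expect_pairField_sWave_le (L : ℕ) [NeZero L] (hL : 3 ≤ L) {n : ℕ} (hn : n ≤ L ^ 2)
    {ψ : Fock (Orb (FermionTorus 2 L))} (hψ : IsInSector n n ψ) :
    (expect ((pairField sWave L)ᴴ * pairField sWave L) ψ).re ≤
      2 * ((n : ℝ) * ((L : ℝ) ^ 2 - n + 1)) * (star ψ ⬝ᵥ ψ).re := by
  have hN : IsNParticle (2 * n) ψ := by rw [two_mul]; exact hψ.isNParticle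
  have h := re_expect_pairField_conjTranspose_mul_le_yang sWave L sWave_neg hL (even_two_mul n)
    (by omega : 2 * n ≤ 2 * L ^ 2) hN
  rw [sum_sq_sWave] at h
  have hL0 : (0 : ℝ) < (L : ℝ) ^ 2 := by
    have : (0 : ℝ) < (L : ℝ) := by exact_mod_cast Nat.pos_of_ne_zero (NeZero.ne L)
    positivity
  have hcoef : ((2 * n : ℕ) : ℝ) * (2 * (L : ℝ) ^ 2 - (2 * n : ℕ) + 2) / (2 * (L : ℝ) ^ 2) *
      ((L : ℝ) ^ 2 * 1) = 2 * ((n : ℝ) * ((L : ℝ) ^ 2 - n + 1)) := by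
    field_simp
    push_cast
    ring
  rwa [hcoef] at h

/-- **The crude cap `F_s(ψ) ≤ 2L⁴` for normalised sector vectors** (`L ≥ 3`, `n ≤ L²`):
`2n(L² - n + 1) ≤ 2L⁴` since `n² ≥ n`. Yang, Rev. Mod. Phys. 34 (1962) 694, §4. [folklore] -/
theorem re_expect_pairField_sWave_le_two_mul_pow_four (L : ℕ) [NeZero L] (hL : 3 ≤ L) {n : ℕ}
    (hn : n ≤ L ^ 2) {ψ : Fock (Orb (FermionTorus 2 L))} (hψ1 : star ψ ⬝ᵥ ψ = 1)
    (hψ : IsInSector n n ψ) :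
    (expect ((pairField sWave L)ᴴ * pairField sWave L) ψ).re ≤ 2 * (L : ℝ) ^ 4 := by
  have h := re_expect_pairField_sWave_le L hL hn hψ
  rw [hψ1, Complex.one_re, mul_one] at h
  have hn' : (n : ℝ) ≤ (L : ℝ) ^ 2 := by exact_mod_cast hn
  have hn2 : (n : ℝ) ≤ (n : ℝ) ^ 2 := by
    rcases Nat.eq_zero_or_pos n with h0 | hpos
    · subst h0; simp
    · have : (1 : ℝ) ≤ n := by exact_mod_cast hpos
      nlinarith
  have hn0 : (0 : ℝ) ≤ n := Nat.cast_nonneg n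
  nlinarith

/-! ### K2 implies stub T -/

/-- **K2 ⟹ stub T of line `birth`** (the cut through the attractive sibling loses nothing): from
`TwinOnsiteCondensation` at `(U, δ)` with constant `c` beyond `L₀`, stub `stub_twinDominatesAttractive`
holds at the same `(U, δ)` with `U' = -1`, `θ = c/2` beyond `max L₀ 3` — a normalised attractive sector
ground state `ψ` exists (`exists_unit_isGroundStateInSector_hubbardTorus`) and obeys Yang's cap
`F_s(ψ) ≤ 2L⁴`, so `θ·F_s(ψ) ≤ cL⁴ ≤ F_s(φ̃)`. Yang, Rev. Mod. Phys. 34 (1962) 694, §4; Lieb, PRL 62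
(1989) 1201. [folklore] -/
theorem twinDominatesAttractive_of_twinOnsiteCondensation :
    TwinOnsiteCondensation →
      ∃ U ∈ Set.Ioc (0 : ℝ) 4, ∃ δ ∈ Set.Icc (1 / 10 : ℝ) (3 / 10), ∃ U' : ℝ, U' < 0 ∧ ∃ θ : ℝ, 0 < θ ∧
        ∃ L₀ : ℕ, ∀ (L : ℕ) [NeZero L], L₀ ≤ L → Even L →
          ∀ φ : Fock (Orb (FermionTorus 2 L)), star φ ⬝ᵥ φ = 1 →
            IsGroundStateInSector (hubbardTorus 2 L 1 U) (2 * ⌊(1 - δ) * (L : ℝ) ^ 2 / 2⌋₊) 0 φ →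
            ∃ ψ : Fock (Orb (FermionTorus 2 L)), star ψ ⬝ᵥ ψ = 1 ∧
              IsGroundStateInSector (hubbardTorus 2 L 1 U') (2 * ⌊(1 - δ) * (L : ℝ) ^ 2 / 2⌋₊) 0 ψ ∧
              θ * (expect ((pairField sWave L)ᴴ * pairField sWave L) ψ).re ≤
                (expect ((pairField sWave L)ᴴ * pairField sWave L)
                  (liebVec ⌊(1 - δ) * (L : ℝ) ^ 2 / 2⌋₊
                    (CFC.abs (liebW ⌊(1 - δ) * (L : ℝ) ^ 2 / 2⌋₊ φ)))).re := by
  rintro ⟨U, hU, δ, hδ, c, hc, L₀, h2⟩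
  refine ⟨U, hU, δ, hδ, -1, by norm_num, c / 2, by positivity, max L₀ 3, ?_⟩
  intro L _ hL hE φ hφ hgs
  have hn : ⌊(1 - δ) * (L : ℝ) ^ 2 / 2⌋₊ ≤ L ^ 2 := natFloor_filling_le_sq (by linarith [hδ.1]) L
  obtain ⟨ψ, hψ1, hψgs⟩ :=
    exists_unit_isGroundStateInSector_hubbardTorus (-1) L ⌊(1 - δ) * (L : ℝ) ^ 2 / 2⌋₊ hn
  refine ⟨ψ, hψ1, hψgs, ?_⟩
  have hsec : IsInSector ⌊(1 - δ) * (L : ℝ) ^ 2 / 2⌋₊ ⌊(1 - δ) * (L : ℝ) ^ 2 / 2⌋₊ ψ :=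
    (mem_szSector_two_mul_zero_iff _ ψ).1 hψgs.1
  have hcap := re_expect_pairField_sWave_le_two_mul_pow_four L (le_of_max_le_right hL) hn hψ1 hsec
  have hfloor := h2 L (le_of_max_le_left hL) hE φ hφ hgs
  calc c / 2 * (expect ((pairField sWave L)ᴴ * pairField sWave L) ψ).re
      ≤ c / 2 * (2 * (L : ℝ) ^ 4) := mul_le_mul_of_nonneg_left hcap (by positivity)
    _ = c * (L : ℝ) ^ 4 := by ring
    _ ≤ _ := hfloor

end Summit.HubbardSuperconductivity.HubbardSuperconductivity.Theorems.LiebTwinTwin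

end
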